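import Summits.Ventures.LatticeQCDFlow.Exactness.IMHCoupledEstimatorCLT
import HarnessLib

/-!
# The studentised interval for the coupled flow-MCMC estimator is asymptotically exact: `√R·(H̄_R − π f)/σ̂_R ⇒ N(0, 1)` —
# Slutsky with the replicas' own sample variance, centred at `π f` itself

HONEST FRAMING: exact (Metropolis-corrected) sampling algorithms for lattice gauge theory;
figures of merit are autocorrelation/cost numbers at stated couplings and volumes; no
continuum-physics claim.

Venture `LatticeQCDFlow` (cell pub-lqcd), topic `Exactness`; FANOUT row 30 (lean-1, GEN-39).  NEW WORK of the cell;
sequel to GEN-38's `Exactness/IMHCoupledEstimatorCLT` (for mutually independent pair streams `Z_0, Z_1, …` from ONE initial coupling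
one update ahead, `(√R)⁻¹(Σ_{j<R} H_k(Z_j) − R·π f) ⇒ N(0, Var H_k)` with the UNKNOWN variance `Var H_k`; «NOT CLAIMED: a studentised
(Slutsky) interval»).  Here the variance is replaced by the replicas' own sample variance
`σ̂²_R = R⁻¹Σ_{j<R} H_j² − (R⁻¹Σ_{j<R} H_j)²` — what is printed — and the limit is the STANDARD normal law:

* §1 (generic, [ours]; Mathlib's CLT, strong law and Slutsky theorem APPLIED) **`tendstoInDistribution_studentised`** — for an
  i.i.d. (mutually independent, identically distributed) square-integrable sequence `X_j` with `Var X_0 > 0` and `Y ∼ N(0, Var X_0)`: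
  `(√R)⁻¹(Σ_{j<R} X_j − R·E X_0)/σ̂_R ⇒ Y/√(Var X_0)`; **`ae_tendsto_sampleVariance`** — `σ̂²_R → Var X_0` almost surely;
  **`hasLaw_div_sqrt_variance`** — `Y/√(Var X_0) ∼ N(0, 1)`.
* §2 **`crnLag_untruncated_replicas_studentised_clt`** — THE STUDENTISED CLT FOR THE EXACTLY UNBIASED COUPLED ESTIMATOR:
  `(√R)⁻¹(Σ_{j<R} H_k(Z_j) − R·π f)/σ̂_R ⇒ N(0, 1)` whenever `Var H_k > 0` — centred at `π f` ITSELF, from every starting law, no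
  variance or autocorrelation input: the printed interval `H̄_R ± z·σ̂_R/√R` has asymptotically the nominal coverage;
  **`crnLag_replicas_studentised_clt`** — the same for the truncated estimator `H_{k,N}` about its exact mean `m_{k,N}`
  (`|m_{k,N} − π f| ≤ r^{k+N}(c − a)`, GEN-38).
Reading (gauge files): for `R` independent coupled pairs of two exact gauge samplers on one stream of random numbers the
t-statistic of the burn-in-free estimates about the exact expectation value is asymptotically standard normal.
NOT CLAIMED: Berry–Esseen ∕ any finite-`R` coverage statement (GEN-38's Chebyshev bars are the finite-`R` certificates); the
degenerate case `Var H_k = 0`; the `R − 1` normalisation (asymptotically identical, not typed); anything for unbounded `f` or any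
value of `A`.  No `sorry`, no new definitions, nothing cited as a fact.
-/

noncomputable section

namespace Summit.Ventures.LatticeQCDFlow.Exactness

open MeasureTheory ProbabilityTheory Function Finset Filter
open scoped ENNReal unitInterval Topology
open Summit.Ventures.LatticeQCDFlow.Scoring

variable {Ω : Type*} [MeasurableSpace Ω] {q : Measure Ω} [IsProbabilityMeasure q] {w : Ω → ℝ}

section Generic

variable {Ω' : Type*} {mΩ' : MeasurableSpace Ω'} {μ : Measure Ω'} [IsProbabilityMeasure μ]
  {Ω'' : Type*} {mΩ'' : MeasurableSpace Ω''} {P' : Measure Ω''} [IsProbabilityMeasure P'] {Y : Ω'' → ℝ}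
  {X : ℕ → Ω' → ℝ}

/-! ## §1 Studentisation by Slutsky's theorem (generic) -/

/-- **THE SAMPLE VARIANCE IS STRONGLY CONSISTENT**: for a pairwise independent identically distributed square-integrable sequence,
`R⁻¹Σ_{j<R} X_j² − (R⁻¹Σ_{j<R} X_j)² → Var X_0` almost surely (Mathlib's strong law applied twice). [ours] -/
theorem ae_tendsto_sampleVariance (hX2 : MemLp (X 0) 2 μ) (hindep : Pairwise ((· ⟂ᵢ[μ] ·) on X))
    (hident : ∀ i, IdentDistrib (X i) (X 0) μ μ) :
    ∀ᵐ ω ∂μ, Tendsto (fun R : ℕ => (R : ℝ)⁻¹ * ∑ j ∈ range R, X j ω ^ 2 - ((R : ℝ)⁻¹ * ∑ j ∈ range R, X j ω) ^ 2)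
      atTop (𝓝 Var[X 0; μ]) := by
  have hXm : ∀ i, AEMeasurable (X i) μ := fun i => (hident i).aemeasurable_fst
  have h1 := strong_law_ae X (hX2.integrable one_le_two) hindep hident
  have hsq_int : Integrable (fun ω => X 0 ω ^ 2) μ := hX2.integrable_sq
  have hsq_indep : Pairwise ((· ⟂ᵢ[μ] ·) on fun i ω => X i ω ^ 2) := fun i j hij =>
    (hindep hij).comp (measurable_id.pow_const 2) (measurable_id.pow_const 2)
  have hsq_ident : ∀ i, IdentDistrib (fun ω => X i ω ^ 2) (fun ω => X 0 ω ^ 2) μ μ := fun i =>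
    (hident i).comp (measurable_id.pow_const 2)
  have h2 := strong_law_ae (fun i ω => X i ω ^ 2) hsq_int hsq_indep hsq_ident
  have hvar : Var[X 0; μ] = μ[fun ω => X 0 ω ^ 2] - μ[X 0] ^ 2 := by
    rw [variance_eq_sub hX2]; rfl
  filter_upwards [h1, h2] with ω hω1 hω2
  simp only [smul_eq_mul] at hω1 hω2
  rw [hvar]
  exact hω2.sub (hω1.pow 2)

omit [IsProbabilityMeasure μ] [IsProbabilityMeasure P'] in
/-- **`Y/√(Var X_0) ∼ N(0, 1)`** when `Y ∼ N(0, Var X_0)` and `Var X_0 > 0`. [ours, bookkeeping — Mathlib's `gaussianReal_div_const`] -/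
theorem hasLaw_div_sqrt_variance (hvar : 0 < Var[X 0; μ]) (hY : HasLaw Y (gaussianReal 0 (Var[X 0; μ]).toNNReal) P') :
    HasLaw (fun ω' => Y ω' / √(Var[X 0; μ])) (gaussianReal 0 1) P' := by
  have h := gaussianReal_div_const hY (√(Var[X 0; μ]))
  have hv : (Var[X 0; μ]).toNNReal / NNReal.mk (√(Var[X 0; μ]) ^ 2) (sq_nonneg _) = 1 := by
    apply NNReal.coe_injective
    rw [NNReal.coe_div, Real.coe_toNNReal _ hvar.le, NNReal.coe_mk, Real.sq_sqrt hvar.le, NNReal.coe_one, div_self hvar.ne']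
  rwa [zero_div, hv] at h

/-- **STUDENTISATION (Slutsky)**: for mutually independent identically distributed square-integrable `X_j` with `Var X_0 > 0` and
`Y ∼ N(0, Var X_0)`: `(√R)⁻¹(Σ_{j<R} X_j − R·E X_0)/σ̂_R ⇒ Y/√(Var X_0)` (law `N(0, 1)` by `hasLaw_div_sqrt_variance`), where
`σ̂²_R = R⁻¹Σ_{j<R} X_j² − (R⁻¹Σ_{j<R} X_j)²` is the sample variance (Mathlib's CLT, strong law and Slutsky theorem applied). [ours] -/
theorem tendstoInDistribution_studentised (hX2 : MemLp (X 0) 2 μ) (hindep : iIndepFun X μ)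
    (hident : ∀ i, IdentDistrib (X i) (X 0) μ μ) (hvar : 0 < Var[X 0; μ])
    (hY : HasLaw Y (gaussianReal 0 (Var[X 0; μ]).toNNReal) P') :
    TendstoInDistribution
      (fun (R : ℕ) ω => (√(R : ℝ))⁻¹ * (∑ j ∈ range R, X j ω - R * μ[X 0]) /
        √((R : ℝ)⁻¹ * ∑ j ∈ range R, X j ω ^ 2 - ((R : ℝ)⁻¹ * ∑ j ∈ range R, X j ω) ^ 2))
      atTop (fun ω' => Y ω' / √(Var[X 0; μ])) (fun _ => μ) P' := by
  have hXm : ∀ i, AEMeasurable (X i) μ := fun i => (hident i).aemeasurable_fst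
  have hclt := tendstoInDistribution_inv_sqrt_mul_sum_sub hY hX2 hindep hident
  -- the studentising factor converges almost surely, hence in probability, to `1/√Var`
  have hS := ae_tendsto_sampleVariance hX2 (fun i j hij => hindep.indepFun hij) hident
  have hσ : √(Var[X 0; μ]) ≠ 0 := (Real.sqrt_pos.2 hvar).ne'
  have hae : ∀ᵐ ω ∂μ, Tendsto (fun R : ℕ =>
      (√((R : ℝ)⁻¹ * ∑ j ∈ range R, X j ω ^ 2 - ((R : ℝ)⁻¹ * ∑ j ∈ range R, X j ω) ^ 2))⁻¹) atTop
        (𝓝 (√(Var[X 0; μ]))⁻¹) := by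
    filter_upwards [hS] with ω hω
    exact (hω.sqrt).inv₀ hσ
  have hFm : ∀ R : ℕ, AEMeasurable (fun ω =>
      (√((R : ℝ)⁻¹ * ∑ j ∈ range R, X j ω ^ 2 - ((R : ℝ)⁻¹ * ∑ j ∈ range R, X j ω) ^ 2))⁻¹) μ := fun R =>
    (Real.continuous_sqrt.measurable.comp_aemeasurable
      (((Finset.aemeasurable_fun_sum _ fun j _ => (hXm j).pow_const 2).const_mul _).sub
        (((Finset.aemeasurable_fun_sum _ fun j _ => hXm j).const_mul _).pow_const 2))).inv
  have hprob : TendstoInMeasure μ (fun (R : ℕ) ω =>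
      (√((R : ℝ)⁻¹ * ∑ j ∈ range R, X j ω ^ 2 - ((R : ℝ)⁻¹ * ∑ j ∈ range R, X j ω) ^ 2))⁻¹) atTop
        (fun _ => (√(Var[X 0; μ]))⁻¹) :=
    tendstoInMeasure_of_tendsto_ae (fun R => (hFm R).aestronglyMeasurable) hae
  have h := hclt.continuous_comp_prodMk_of_tendstoInMeasure_const (g := fun p : ℝ × ℝ => p.1 * p.2) (by fun_prop) hprob hFm
  simp only [div_eq_mul_inv]
  exact h

end Generic

section Replicas

variable {Ω' : Type*} {mΩ' : MeasurableSpace Ω'} {μ : Measure Ω'} [IsProbabilityMeasure μ]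
  {Z : ℕ → Ω' → (ℕ → Ω × Ω)}
  {Ω'' : Type*} {mΩ'' : MeasurableSpace Ω''} {P' : Measure Ω''} [IsProbabilityMeasure P'] {Y : Ω'' → ℝ}

/-! ## §2 The studentised central limit theorems for the coupled estimator -/

/-- **THE STUDENTISED CLT FOR THE EXACTLY UNBIASED COUPLED ESTIMATOR.**  `w` measurable (a `Fact`), positive, normalised, maximal at
`x₀`; `MeasurableEq Ω`; `K̂` a CRN pair kernel; `Z_0, Z_1, …` mutually independent pair streams, each distributed as the pair chain from
ONE initial coupling `ν̂` one update ahead; `a ≤ f ≤ c` measurable; `H_j = H_k(Z_j)` the untruncated coupled estimates with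
`Var H_0 > 0`; `Y ∼ N(0, Var H_0)`.  Then `(√R)⁻¹(Σ_{j<R} H_j − R·π f)/σ̂_R ⇒ Y/√(Var H_0) ∼ N(0, 1)` with the SAMPLE variance
`σ̂²_R = R⁻¹Σ H_j² − (R⁻¹Σ H_j)²` — centred at `π f` itself. [ours — Mathlib's CLT, strong law and Slutsky theorem applied] -/
theorem crnLag_untruncated_replicas_studentised_clt [MeasurableEq Ω] [Fact (Measurable w)] (hw0 : ∀ y, 0 < w y) {x₀ : Ω}
    (hmax : ∀ y, w y ≤ w x₀) [IsProbabilityMeasure (q.withDensity fun y => ENNReal.ofReal (w y))]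
    (Khat : Kernel (Ω × Ω) (Ω × Ω)) [IsMarkovKernel Khat]
    (hK : ∀ z : Ω × Ω, Khat z = (q.prod (volume : Measure unitInterval)).map (fun p : Ω × unitInterval =>
      ((if (p.2 : ℝ) * w z.1 ≤ w p.1 then p.1 else z.1), (if (p.2 : ℝ) * w z.2 ≤ w p.1 then p.1 else z.2))))
    (ν : Measure (Ω × Ω)) [IsProbabilityMeasure ν] (hlag : ν.map Prod.fst = (ν.map Prod.snd).bind (indepMH q w))
    {f : Ω → ℝ} (hf : Measurable f) {a c : ℝ} (ha : ∀ x, a ≤ f x) (hc : ∀ x, f x ≤ c) (k : ℕ)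
    (hZm : ∀ j, Measurable (Z j))
    (hlaw : ∀ j, μ.map (Z j) = Kernel.trajMeasure (X := fun _ : ℕ => Ω × Ω) ν
      (fun n : ℕ => Khat.comap (fun h : (i : ↥(Finset.Iic n)) → Ω × Ω => h ⟨n, Finset.mem_Iic.2 le_rfl⟩)
        (measurable_pi_apply _)))
    (hind : iIndepFun Z μ)
    (hvar : 0 < Var[fun ω => f ((Z 0 ω k).2) + ∑' n, (f ((Z 0 ω (k + n)).1) - f ((Z 0 ω (k + n)).2)); μ])
    (hY : HasLaw Y (gaussianReal 0
      (Var[fun ω => f ((Z 0 ω k).2) + ∑' n, (f ((Z 0 ω (k + n)).1) - f ((Z 0 ω (k + n)).2)); μ]).toNNReal) P') :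
    TendstoInDistribution
      (fun (R : ℕ) ω => (√(R : ℝ))⁻¹ *
        (∑ j ∈ range R, (f ((Z j ω k).2) + ∑' n, (f ((Z j ω (k + n)).1) - f ((Z j ω (k + n)).2))) -
          R * ∫ x, f x ∂(q.withDensity fun y => ENNReal.ofReal (w y))) /
        √((R : ℝ)⁻¹ * ∑ j ∈ range R, (f ((Z j ω k).2) + ∑' n, (f ((Z j ω (k + n)).1) - f ((Z j ω (k + n)).2))) ^ 2 -
          ((R : ℝ)⁻¹ * ∑ j ∈ range R, (f ((Z j ω k).2) + ∑' n, (f ((Z j ω (k + n)).1) - f ((Z j ω (k + n)).2)))) ^ 2))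
      atTop (fun ω' => Y ω' / √(Var[fun ω => f ((Z 0 ω k).2) + ∑' n, (f ((Z 0 ω (k + n)).1) - f ((Z 0 ω (k + n)).2)); μ]))
      (fun _ => μ) P' ∧
    HasLaw (fun ω' => Y ω' / √(Var[fun ω => f ((Z 0 ω k).2) + ∑' n, (f ((Z 0 ω (k + n)).1) - f ((Z 0 ω (k + n)).2)); μ]))
      (gaussianReal 0 1) P' := by
  have hHasm' := fun j => (crnLag_untruncated_replicas_identDistrib hw0 hmax Khat hK ν hf k hZm hlaw j).1
  have hident := fun j => (crnLag_untruncated_replicas_identDistrib hw0 hmax Khat hK ν hf k hZm hlaw j).2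
  have hindep := crnLag_untruncated_replicas_iIndepFun hw0 hmax Khat hK ν hf k hZm hlaw hind
  have hX2 : MemLp (fun ω => f ((Z 0 ω k).2) + ∑' n, (f ((Z 0 ω (k + n)).1) - f ((Z 0 ω (k + n)).2))) 2 μ :=
    memLp_crnLag_untruncated_replica hw0 hmax Khat hK ν hf ha hc k hZm (hlaw 0)
  have hmean : μ[fun ω => f ((Z 0 ω k).2) + ∑' n, (f ((Z 0 ω (k + n)).1) - f ((Z 0 ω (k + n)).2))] =
      ∫ x, f x ∂(q.withDensity fun y => ENNReal.ofReal (w y)) := by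
    rw [← integral_map (hZm 0).aemeasurable (hHasm' 0), hlaw 0]
    have hYi : Integrable (fun z : ℕ → Ω × Ω => f ((z k).2))
        (Kernel.trajMeasure (X := fun _ : ℕ => Ω × Ω) ν
          (fun n : ℕ => Khat.comap (fun h : (i : ↥(Finset.Iic n)) → Ω × Ω => h ⟨n, Finset.mem_Iic.2 le_rfl⟩)
            (measurable_pi_apply _))) :=
      integrable_of_bounded _ (hf.comp (measurable_snd.comp (measurable_pi_apply k))) (fun z =>
        abs_le_max_abs_abs (ha _) (hc _))
    have hTi : Integrable (fun z : ℕ → Ω × Ω => ∑' n, (f ((z (k + n)).1) - f ((z (k + n)).2)))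
        (Kernel.trajMeasure (X := fun _ : ℕ => Ω × Ω) ν
          (fun n : ℕ => Khat.comap (fun h : (i : ↥(Finset.Iic n)) → Ω × Ω => h ⟨n, Finset.mem_Iic.2 le_rfl⟩)
            (measurable_pi_apply _))) := by
      have h := (crnLag_untruncated_memLp_two hw0 hmax Khat hK ν hf ha hc k).integrable one_le_two
      refine (h.sub hYi).congr (ae_of_all _ fun z => ?_)
      simp only [Pi.sub_apply, add_sub_cancel_left]
    rw [integral_add hYi hTi]
    exact crnLag_unbiased hw0 hmax Khat hK ν hlag hf ha hc k
  have h := tendstoInDistribution_studentised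
    (X := fun j ω => f ((Z j ω k).2) + ∑' n, (f ((Z j ω (k + n)).1) - f ((Z j ω (k + n)).2))) hX2 hindep hident hvar hY
  rw [hmean] at h
  exact ⟨h, hasLaw_div_sqrt_variance (X := fun j ω => f ((Z j ω k).2) + ∑' n, (f ((Z j ω (k + n)).1) - f ((Z j ω (k + n)).2)))
    hvar hY⟩

/-- **THE STUDENTISED CLT FOR THE TRUNCATED COUPLED ESTIMATOR `H_{k,N}`** (no `MeasurableEq`, no maximality): with
`m_{k,N} = (ν₂K^{k+N}) f` its exact mean and `Var H_{k,N}(Z_0) > 0`, `(√R)⁻¹(Σ_{j<R} H_{k,N}(Z_j) − R·m_{k,N})/σ̂_R ⇒ N(0, 1)`.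
[ours — Mathlib's CLT, strong law and Slutsky theorem applied] -/
theorem crnLag_replicas_studentised_clt [Fact (Measurable w)] (hw0 : ∀ y, 0 < w y)
    (Khat : Kernel (Ω × Ω) (Ω × Ω)) [IsMarkovKernel Khat]
    (hK : ∀ z : Ω × Ω, Khat z = (q.prod (volume : Measure unitInterval)).map (fun p : Ω × unitInterval =>
      ((if (p.2 : ℝ) * w z.1 ≤ w p.1 then p.1 else z.1), (if (p.2 : ℝ) * w z.2 ≤ w p.1 then p.1 else z.2))))
    (ν : Measure (Ω × Ω)) [IsProbabilityMeasure ν] (hlag : ν.map Prod.fst = (ν.map Prod.snd).bind (indepMH q w))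
    {f : Ω → ℝ} (hf : Measurable f) {a c : ℝ} (ha : ∀ x, a ≤ f x) (hc : ∀ x, f x ≤ c) (k N : ℕ)
    (hZm : ∀ j, Measurable (Z j))
    (hlaw : ∀ j, μ.map (Z j) = Kernel.trajMeasure (X := fun _ : ℕ => Ω × Ω) ν
      (fun n : ℕ => Khat.comap (fun h : (i : ↥(Finset.Iic n)) → Ω × Ω => h ⟨n, Finset.mem_Iic.2 le_rfl⟩)
        (measurable_pi_apply _)))
    (hind : iIndepFun Z μ)
    (hvar : 0 < Var[fun ω => f ((Z 0 ω k).2) + ∑ n ∈ range N, (f ((Z 0 ω (k + n)).1) - f ((Z 0 ω (k + n)).2)); μ])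
    (hY : HasLaw Y (gaussianReal 0
      (Var[fun ω => f ((Z 0 ω k).2) + ∑ n ∈ range N, (f ((Z 0 ω (k + n)).1) - f ((Z 0 ω (k + n)).2)); μ]).toNNReal) P') :
    TendstoInDistribution
      (fun (R : ℕ) ω => (√(R : ℝ))⁻¹ *
        (∑ j ∈ range R, (f ((Z j ω k).2) + ∑ n ∈ range N, (f ((Z j ω (k + n)).1) - f ((Z j ω (k + n)).2))) -
          R * ∫ y, f y ∂((fun m : Measure Ω => m.bind (indepMH q w))^[k + N] (ν.map Prod.snd))) /
        √((R : ℝ)⁻¹ * ∑ j ∈ range R, (f ((Z j ω k).2) + ∑ n ∈ range N, (f ((Z j ω (k + n)).1) - f ((Z j ω (k + n)).2))) ^ 2 -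
          ((R : ℝ)⁻¹ * ∑ j ∈ range R, (f ((Z j ω k).2) + ∑ n ∈ range N, (f ((Z j ω (k + n)).1) - f ((Z j ω (k + n)).2)))) ^ 2))
      atTop (fun ω' => Y ω' / √(Var[fun ω => f ((Z 0 ω k).2) + ∑ n ∈ range N, (f ((Z 0 ω (k + n)).1) - f ((Z 0 ω (k + n)).2)); μ]))
      (fun _ => μ) P' ∧
    HasLaw (fun ω' => Y ω' / √(Var[fun ω => f ((Z 0 ω k).2) + ∑ n ∈ range N, (f ((Z 0 ω (k + n)).1) - f ((Z 0 ω (k + n)).2)); μ]))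
      (gaussianReal 0 1) P' := by
  have hHm : Measurable fun z : ℕ → Ω × Ω => f ((z k).2) + ∑ n ∈ range N, (f ((z (k + n)).1) - f ((z (k + n)).2)) :=
    measurable_crnLagEstimator hf k N
  have hC : ∀ x, |f x| ≤ max |a| |c| := fun x => abs_le_max_abs_abs (ha x) (hc x)
  have hX2 : MemLp (fun ω => f ((Z 0 ω k).2) + ∑ n ∈ range N, (f ((Z 0 ω (k + n)).1) - f ((Z 0 ω (k + n)).2))) 2 μ :=
    memLp_crnLag_replica hf ha hc k N hZm 0
  have hindep := crnLag_replicas_iIndepFun (μ := μ) hHm hind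
  have hident := crnLag_replicas_identDistrib (μ := μ) hHm hZm hlaw
  have hmean : μ[fun ω => f ((Z 0 ω k).2) + ∑ n ∈ range N, (f ((Z 0 ω (k + n)).1) - f ((Z 0 ω (k + n)).2))] =
      ∫ y, f y ∂((fun m : Measure Ω => m.bind (indepMH q w))^[k + N] (ν.map Prod.snd)) := by
    rw [integral_comp_eq_of_map_eq (hZm 0) (hlaw 0) hHm]
    exact crnLag_truncated_integral_eq hw0 Khat hK ν hlag hf hC k N
  have h := tendstoInDistribution_studentised
    (X := fun j ω => f ((Z j ω k).2) + ∑ n ∈ range N, (f ((Z j ω (k + n)).1) - f ((Z j ω (k + n)).2))) hX2 hindep hident hvar hY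
  rw [hmean] at h
  exact ⟨h, hasLaw_div_sqrt_variance
    (X := fun j ω => f ((Z j ω k).2) + ∑ n ∈ range N, (f ((Z j ω (k + n)).1) - f ((Z j ω (k + n)).2))) hvar hY⟩

end Replicas

end Summit.Ventures.LatticeQCDFlow.Exactness

end
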